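import Mathlib
import Literature.NumberTheory.Automorphic.CompactGroupKFiniteVectors
import Literature.NumberTheory.Automorphic.AutomorphicFormsGKModuleProofs
import Literature.NumberTheory.Automorphic.AutomorphicFormsGLContinuous
import HarnessLib

/-!
# `K_∞`-type control by polynomial smearing (stub `stub_A` of line `BaireSketch`)

Crux `HeckeEigenvalueField` (stmt-Langlands-13632), step (A) of S4: the matrix coefficients `M d` of
the polynomial functions of degree `≤ d` on the compact group `K_∞ = Kinf n K` control the
`K_∞`-types of the smears `φ ⋆ p = ∫_{K_∞} p(k) r(k) φ dk` of an automorphic form `φ` by polynomials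
`p`, and some such smear leaves any subspace `W' ∌ φ` (Stone–Weierstrass). Borel–Jacquet (Corvallis
1979), 4.2–4.3; Bröcker–tom Dieck (1985), III §1, (4.3), (5.5)–(5.7). [folklore]
-/

set_option linter.dupNamespace false

noncomputable section

open scoped Classical ComplexConjugate
open MeasureTheory Literature.NumberTheory.Automorphic NumberField NumberField.mixedEmbedding
  IsDedekindDomain

namespace Summit.Langlands.Langlands.Theorems.HeckeEigenvalueField.Baire

section Helpers

variable {G : Type*} [TopologicalSpace G] [Group G]

/-- **Matrix coefficients of a finite-dimensional left-translation stable space `P ≤ C(G, ℂ)`**: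
the span `M` of the matrix entries `k ↦ (λ(k)|_P)_{ij}` in a basis of `P` is finite-dimensional,
stable under `f ↦ f(· k₀)` (as `λ(k k₀) = λ(k) λ(k₀)`), and contains every matrix coefficient
`k ↦ Λ (λ(k) q)`, `q ∈ P`, `Λ` linear. Bröcker–tom Dieck (1985), III §1. [folklore] -/
theorem exists_coeffSpace [IsTopologicalGroup G] (P : Submodule ℂ C(G, ℂ)) [FiniteDimensional ℂ P]
    (hP : ∀ k : G, ∀ q ∈ P, leftTranslate k q ∈ P) :
    ∃ M : Submodule ℂ (G → ℂ), FiniteDimensional ℂ M ∧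
      (∀ k₀ : G, ∀ f ∈ M, (fun k => f (k * k₀)) ∈ M) ∧
      ∀ (Λ : C(G, ℂ) →ₗ[ℂ] ℂ), ∀ q ∈ P, (fun k => Λ (leftTranslate k q)) ∈ M := by
  -- the left translations restricted to `P` and their matrix entries in a basis of `P`
  let T : G → P →ₗ[ℂ] P := fun k =>
    { toFun := fun q => ⟨leftTranslate k q, hP k q q.2⟩
      map_add' := fun q₁ q₂ => Subtype.ext (leftTranslate_add k q₁ q₂)
      map_smul' := fun c q => Subtype.ext (leftTranslate_smul k c q) }
  have hT : ∀ (k k₀ : G) (q : P), T (k * k₀) q = T k (T k₀ q) := fun k k₀ q =>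
    Subtype.ext (leftTranslate_mul_left k k₀ q)
  haveI : Module.Free ℂ P := Module.Free.of_divisionRing ℂ P
  let bP := Module.finBasis ℂ P
  obtain ⟨e, he⟩ : ∃ e : Fin (Module.finrank ℂ P) × Fin (Module.finrank ℂ P) → (G → ℂ),
      ∀ ij k, e ij k = bP.repr (T k (bP ij.2)) ij.1 := ⟨_, fun _ _ => rfl⟩
  have hexp : ∀ (k : G) (v : P) (i : Fin (Module.finrank ℂ P)),
      bP.repr (T k v) i = ∑ j, bP.repr v j * bP.repr (T k (bP j)) i := fun k v i => by
    have h := congrArg (fun w : P => bP.repr (T k w) i) (bP.sum_repr v).symm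
    simpa only [map_sum, map_smul, Finsupp.coe_finsetSum, Finset.sum_apply, Finsupp.coe_smul,
      Pi.smul_apply, smul_eq_mul] using h
  -- every coordinate `k ↦ (T k v)_i` lies in the span `M` of the matrix entries
  have hmemM : ∀ (i : Fin (Module.finrank ℂ P)) (v : P),
      (fun k => bP.repr (T k v) i) ∈ Submodule.span ℂ (Set.range e) := by
    intro i v
    have hv : (fun k => bP.repr (T k v) i) = ∑ j, bP.repr v j • e (i, j) := by
      funext k; rw [hexp, Finset.sum_apply]; simp only [Pi.smul_apply, smul_eq_mul, he]
    rw [hv]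
    exact Submodule.sum_mem _ fun j _ =>
      Submodule.smul_mem _ _ (Submodule.subset_span ⟨(i, j), rfl⟩)
  refine ⟨Submodule.span ℂ (Set.range e), FiniteDimensional.span_of_finite ℂ (Set.finite_range e),
    fun k₀ f hf => ?_, fun Λ q hq => ?_⟩
  · -- right-translation stability
    let R : (G → ℂ) →ₗ[ℂ] (G → ℂ) :=
      { toFun := fun f k => f (k * k₀), map_add' := fun _ _ => rfl, map_smul' := fun _ _ => rfl }
    have hR : (Submodule.span ℂ (Set.range e)).map R ≤ Submodule.span ℂ (Set.range e) := by
      rw [Submodule.map_span, Submodule.span_le]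
      rintro _ ⟨_, ⟨⟨i, j⟩, rfl⟩, rfl⟩
      have hij : R (e (i, j)) = fun k => bP.repr (T k (T k₀ (bP j))) i := by
        funext k; change e (i, j) (k * k₀) = _; rw [he, hT]
      rw [SetLike.mem_coe, hij]
      exact hmemM i _
    exact hR (Submodule.mem_map_of_mem hf)
  · -- matrix coefficients
    have hΛ : (fun k => Λ (leftTranslate k q)) =
        ∑ i, Λ ((bP i : P) : C(G, ℂ)) • fun k => bP.repr (T k ⟨q, hq⟩) i := by
      funext k
      have h1 : leftTranslate k q = ((T k ⟨q, hq⟩ : P) : C(G, ℂ)) := rfl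
      have h2 := congrArg (fun v : P => Λ (v : C(G, ℂ))) (bP.sum_repr (T k ⟨q, hq⟩)).symm
      simp only [Submodule.coe_sum, Submodule.coe_smul, map_sum, map_smul, smul_eq_mul] at h2
      rw [h1, h2]; simp only [Finset.sum_apply, Pi.smul_apply, smul_eq_mul]
      exact Finset.sum_congr rfl fun i _ => mul_comm _ _
    rw [hΛ]
    exact Submodule.sum_mem _ fun i _ => Submodule.smul_mem _ _ (hmemM i _)

variable {A : Type*} [Ring A] [TopologicalSpace A] [IsTopologicalRing A] [Algebra ℝ A]
  [ContinuousSMul ℝ A] [FiniteDimensional ℝ A] [T2Space A]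
  {m : Type*} [Fintype m] [DecidableEq m] (S : Subgroup (GL m A)) [IsTopologicalGroup S]
  [CompactSpace S]

/-- **The polynomial filtration of `C(S, ℂ)` for a compact matrix group `S ≤ GL_m(A)`.** With `V`
the complex span of `1` and the real coordinate functions of a basis of the real dual of `M_m(A)`,
each `P d = V ^ d` is finite-dimensional and stable under left translation
(`leftTranslate_coordFun`; left translation is an algebra homomorphism), and
`⋃_d P d ⊇ ℂ[coordinates]` is dense in `C(S, ℂ)` (Stone–Weierstrass: the coordinates are
self-adjoint and separate points). Bröcker–tom Dieck (1985), III §1 and (4.3). [folklore] -/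
theorem exists_polynomial_filtration :
    ∃ P : ℕ → Submodule ℂ C(S, ℂ), (∀ d, FiniteDimensional ℂ (P d)) ∧
      (∀ d (k : S), ∀ q ∈ P d, leftTranslate k q ∈ P d) ∧ Dense (⋃ d, (P d : Set C(S, ℂ))) := by
  let b := Module.finBasis ℝ (Matrix m m A →ₗ[ℝ] ℝ)
  let c : Fin (Module.finrank ℝ (Matrix m m A →ₗ[ℝ] ℝ)) → C(S, ℂ) := fun i => coordFun S (b i)
  let V : Submodule ℂ C(S, ℂ) := Submodule.span ℂ (insert 1 (Set.range c))
  -- every coordinate function is a combination of the `c i`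
  have hcoord : ∀ ℓ : Matrix m m A →ₗ[ℝ] ℝ, coordFun S ℓ ∈ Submodule.span ℂ (Set.range c) := by
    intro ℓ
    rw [← b.sum_repr ℓ, ← coordFunₗ_apply, map_sum]
    refine Submodule.sum_mem _ fun i _ => ?_
    rw [map_smul, coordFunₗ_apply, ← Complex.coe_smul]
    exact Submodule.smul_mem _ _ (Submodule.subset_span ⟨i, rfl⟩)
  have hcV : Submodule.span ℂ (Set.range c) ≤ V := Submodule.span_mono (Set.subset_insert _ _)
  have h1V : (1 : C(S, ℂ)) ∈ V := Submodule.subset_span (Set.mem_insert _ _)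
  -- left translation is an algebra homomorphism of `C(S, ℂ)` preserving `V`
  let L : S → (C(S, ℂ) →ₐ[ℂ] C(S, ℂ)) := fun k =>
    ContinuousMap.compRightAlgHom ℂ ℂ ⟨fun x => k⁻¹ * x, by fun_prop⟩
  have hL : ∀ (k : S) (q : C(S, ℂ)), L k q = leftTranslate k q := fun _ _ => rfl
  have hVmap : ∀ k : S, V.map (L k).toLinearMap ≤ V := fun k => by
    rw [Submodule.map_span, Submodule.span_le]
    rintro _ ⟨q, hq, rfl⟩
    rcases hq with rfl | ⟨i, rfl⟩
    · rw [SetLike.mem_coe, AlgHom.toLinearMap_apply, map_one]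
      exact h1V
    · rw [SetLike.mem_coe, AlgHom.toLinearMap_apply, hL]
      change leftTranslate k (coordFun S (b i)) ∈ V
      rw [leftTranslate_coordFun]
      exact hcV (hcoord _)
  have hdir : Directed (· ≤ ·) (fun d : ℕ => V ^ d) :=
    (pow_right_monotone (M := Submodule ℂ C(S, ℂ)) (Submodule.one_le.2 h1V)).directed_le
  refine ⟨fun d => V ^ d, fun d => ?_, fun d k q hq => ?_, ?_⟩
  · show FiniteDimensional ℂ (V ^ d : Submodule ℂ C(S, ℂ))
    rw [← Submodule.fg_iff_finiteDimensional]
    exact (Submodule.fg_span ((Set.finite_range c).insert 1)).pow d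
  · have hle : (V ^ d).map (L k).toLinearMap ≤ V ^ d := by
      rw [Submodule.map_pow]
      exact pow_le_pow_left' (hVmap k) d
    exact hle (Submodule.mem_map_of_mem hq)
  · show Dense (⋃ d, ((V ^ d : Submodule ℂ C(S, ℂ)) : Set C(S, ℂ)))
    have hself : ∀ i, star (c i) = c i := fun i => by ext k; simp [c]
    -- the star subalgebra generated by the (self-adjoint) `c i` lies in `⋃_d V ^ d` ...
    have hU : ∀ f ∈ StarAlgebra.adjoin ℂ (Set.range c), f ∈ ⨆ d, V ^ d := by
      intro f hf
      rw [← StarSubalgebra.mem_toSubalgebra, StarAlgebra.adjoin_toSubalgebra] at hf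
      have hss : Set.range c ∪ star (Set.range c) = Set.range c := by
        refine Set.union_eq_left.2 ?_
        rintro f ⟨i, hi⟩
        exact ⟨i, by rw [← star_star f, ← hi, hself]⟩
      rw [hss, ← Subalgebra.mem_toSubmodule, Algebra.adjoin_eq_span] at hf
      refine (Submodule.span_le.2 fun x hx => ?_) hf
      induction hx using Submonoid.closure_induction with
      | mem x hx =>
        obtain ⟨i, rfl⟩ := hx
        exact Submodule.mem_iSup_of_mem 1
          (by rw [pow_one]; exact hcV (Submodule.subset_span ⟨i, rfl⟩))
      | one => exact Submodule.mem_iSup_of_mem 0 (by rw [pow_zero]; exact Submodule.one_le.1 le_rfl)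
      | mul x y _ _ hx hy =>
        obtain ⟨a, ha⟩ := (Submodule.mem_iSup_of_directed _ hdir).1 hx
        obtain ⟨a', ha'⟩ := (Submodule.mem_iSup_of_directed _ hdir).1 hy
        exact Submodule.mem_iSup_of_mem (a + a')
          (by rw [pow_add]; exact Submodule.mul_mem_mul ha ha')
    -- ... and separates points, hence is dense (Stone–Weierstrass)
    have hsep : (StarAlgebra.adjoin ℂ (Set.range c)).SeparatesPoints := by
      intro x y hxy
      have hne : ((x : GL m A) : Matrix m m A) - ((y : GL m A) : Matrix m m A) ≠ 0 :=
        sub_ne_zero.2 fun h => hxy (Subtype.ext (Units.ext h))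
      obtain ⟨ℓ, hℓ⟩ := not_forall.1 (mt (Module.forall_dual_apply_eq_zero_iff ℝ _).1 hne)
      have hle : Submodule.span ℂ (Set.range c) ≤
          Subalgebra.toSubmodule (StarAlgebra.adjoin ℂ (Set.range c)).toSubalgebra :=
        Submodule.span_le.2 (StarAlgebra.subset_adjoin ℂ _)
      refine ⟨coordFun S ℓ, ⟨coordFun S ℓ, hle (hcoord ℓ), rfl⟩, fun h => hℓ ?_⟩
      have h' : ((ℓ ((x : GL m A) : Matrix m m A) : ℝ) : ℂ) = ℓ ((y : GL m A) : Matrix m m A) := h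
      rw [map_sub, Complex.ofReal_injective h', sub_self]
    have hdense : Dense ((StarAlgebra.adjoin ℂ (Set.range c) : StarSubalgebra ℂ C(S, ℂ)) :
        Set C(S, ℂ)) := by
      rw [dense_iff_closure_eq, ← StarSubalgebra.topologicalClosure_coe,
        ContinuousMap.starSubalgebra_topologicalClosure_eq_top_of_separatesPoints _ hsep]
      rfl
    exact hdense.mono fun f hf => by rw [← Submodule.coe_iSup_of_directed _ hdir]; exact hU f hf

variable [CompactSpace G] [MeasurableSpace G] [BorelSpace G] (μ : Measure G)
  [IsFiniteMeasureOnCompacts μ] {X : Type*} [Group X] (ι : G →* X) {φ : X → ℂ}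

omit [Group G] in
/-- `p ↦ ∫ p(k) F(k) dμ` is a continuous linear functional on `C(G, ℂ)` for `F ∈ C(G, ℂ)` and a
finite measure on the compact group `G` (bound `‖F‖ μ(G) ‖p‖`). [folklore] -/
theorem exists_integral_clm (F : C(G, ℂ)) :
    ∃ Λ : C(G, ℂ) →L[ℂ] ℂ, ∀ q : C(G, ℂ), Λ q = ∫ k, q k * F k ∂μ := by
  haveI : IsFiniteMeasure μ := CompactSpace.isFiniteMeasure
  have hint : ∀ q : C(G, ℂ), Integrable (fun k => q k * F k) μ := fun q =>
    (q.continuous.mul F.continuous).integrable_of_hasCompactSupport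
      (HasCompactSupport.of_compactSpace _)
  let L : C(G, ℂ) →ₗ[ℂ] ℂ :=
    { toFun := fun q => ∫ k, q k * F k ∂μ
      map_add' := fun q₁ q₂ => by
        simp only [ContinuousMap.add_apply, add_mul]
        exact integral_add (hint q₁) (hint q₂)
      map_smul' := fun c q => by
        simp only [ContinuousMap.smul_apply, smul_eq_mul, mul_assoc, RingHom.id_apply]
        exact integral_const_mul c _ }
  refine ⟨L.mkContinuous (‖F‖ * μ.real Set.univ) fun q => ?_, fun q => rfl⟩
  have h : ∀ᵐ k ∂μ, ‖q k * F k‖ ≤ ‖q‖ * ‖F‖ := Filter.Eventually.of_forall fun k =>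
    (norm_mul _ _).le.trans
      (mul_le_mul (q.norm_coe_le_norm k) (F.norm_coe_le_norm k) (norm_nonneg _) (norm_nonneg _))
  calc ‖L q‖ = ‖∫ k, q k * F k ∂μ‖ := rfl
    _ ≤ ‖q‖ * ‖F‖ * μ.real Set.univ := norm_integral_le_of_norm_le_const h
    _ = ‖F‖ * μ.real Set.univ * ‖q‖ := by ring

/-- Finite linear combinations of evaluations commute with smearing:
`∑ₓ cₓ ∫ p(k) φ(x k) = ∫ p(k) ∑ₓ cₓ φ(x k)` (continuous integrands, compact group). [folklore] -/
theorem finsupp_sum_integral (hφ : ∀ x, Continuous fun k => φ (x * ι k)) (c : X →₀ ℂ)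
    (p : C(G, ℂ)) :
    (c.sum fun x a => a * ∫ k, p k * φ (x * ι k) ∂μ) =
      ∫ k, p k * c.sum (fun x a => a * φ (x * ι k)) ∂μ := by
  simp only [Finsupp.sum, Finset.mul_sum]
  have hint : ∀ x ∈ c.support, Integrable (fun k => p k * (c x * φ (x * ι k))) μ := fun x _ =>
    (p.continuous.mul (continuous_const.mul (hφ x))).integrable_of_hasCompactSupport
      (HasCompactSupport.of_compactSpace _)
  rw [integral_finsetSum _ hint]
  refine Finset.sum_congr rfl fun x _ => ?_; rw [← integral_const_mul]
  exact integral_congr_ae (Filter.Eventually.of_forall fun k => by ring)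

/-- **The smear `x ↦ ∫ p(k) φ(x k) dk` lies in the span `E` of the translates `r(k) φ`** when `E` is
finite-dimensional: a functional `Λ` killing `E` is a finite combination of evaluations on
`E + ℂ (φ ⋆ p)`, so `Λ (φ ⋆ p) = ∫ p(k) Λ(r(k) φ) dk = 0`. Bröcker–tom Dieck (1985), III (5.6).
[folklore] -/
theorem smear_mem_span (hφ : ∀ x, Continuous fun k => φ (x * ι k))
    (hE : FiniteDimensional ℂ (Submodule.span ℂ (Set.range fun k : G => fun x => φ (x * ι k))))
    (p : C(G, ℂ)) :
    (fun x => ∫ k, p k * φ (x * ι k) ∂μ) ∈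
      Submodule.span ℂ (Set.range fun k : G => fun x => φ (x * ι k)) := by
  set E := Submodule.span ℂ (Set.range fun k : G => fun x => φ (x * ι k))
  haveI := hE
  by_contra hv
  obtain ⟨Λ, hΛv, hΛE⟩ := Submodule.exists_dual_map_eq_bot_of_notMem hv inferInstance
  have hΛ0 : ∀ k, Λ (fun x => φ (x * ι k)) = 0 := fun k => by
    have hk : Λ (fun x => φ (x * ι k)) ∈ E.map Λ :=
      Submodule.mem_map_of_mem (Submodule.subset_span ⟨k, rfl⟩)
    rw [hΛE] at hk; exact (Submodule.mem_bot ℂ).1 hk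
  -- restrict `Λ` to the finite-dimensional `F = E + ℂ (φ ⋆ p)`
  let F : Submodule ℂ (X → ℂ) := E ⊔ Submodule.span ℂ {fun x => ∫ k, p k * φ (x * ι k) ∂μ}
  haveI := FiniteDimensional.span_of_finite ℂ
    (Set.finite_singleton (fun x => ∫ k, p k * φ (x * ι k) ∂μ))
  haveI : FiniteDimensional ℂ F := Submodule.finiteDimensional_sup _ _
  obtain ⟨c, hc⟩ := exists_finsupp_sum_eval_eq F (Λ ∘ₗ F.subtype)
  have hc' : ∀ (f : X → ℂ), f ∈ F → (c.sum fun x a => a * f x) = Λ f := fun f hf => hc ⟨f, hf⟩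
  have h1 : (c.sum fun x a => a * ∫ k, p k * φ (x * ι k) ∂μ) =
      Λ (fun x => ∫ k, p k * φ (x * ι k) ∂μ) :=
    hc' _ (Submodule.mem_sup_right (Submodule.mem_span_singleton_self _))
  have h2 : ∀ k, (c.sum fun x a => a * φ (x * ι k)) = 0 := fun k =>
    (hc' _ (Submodule.mem_sup_left (Submodule.subset_span ⟨k, rfl⟩))).trans (hΛ0 k)
  refine hΛv ?_
  rw [← h1, finsupp_sum_integral μ ι hφ c p]
  simp [h2]

omit [CompactSpace G] [IsFiniteMeasureOnCompacts μ] in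
/-- **Slices of a smear**: `∫ p(k) φ(x ι(k₁) ι(k)) dk = ∫ (λ(k₁) p)(k) φ(x ι(k)) dk` (substitute
`k ↦ k₁⁻¹ k` in the left Haar integral; Bröcker–tom Dieck (1985), III (5.5)). [folklore] -/
theorem integral_slice_mul [IsTopologicalGroup G] [μ.IsMulLeftInvariant] (p : C(G, ℂ)) (x : X)
    (k₁ : G) : ∫ k, p k * φ (x * ι k₁ * ι k) ∂μ = ∫ k, leftTranslate k₁ p k * φ (x * ι k) ∂μ := by
  rw [← integral_mul_left_eq_self (fun k => p k * φ (x * ι k₁ * ι k)) k₁⁻¹]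
  refine integral_congr_ae (Filter.Eventually.of_forall fun k => ?_)
  simp only [leftTranslate_apply, map_mul, map_inv, mul_assoc, mul_inv_cancel_left]

/-- **Some smear by an element of a dense `D ⊆ C(G, ℂ)` leaves `W' ∌ φ`** (the span `E` of the
translates `r(k) φ` being finite-dimensional): else a functional `Λ` on `E` with `Λ φ ≠ 0` killing
`W' ∩ E`, a finite combination of evaluations, gives `Λ (φ ⋆ p) = ∫ p h = 0` on `D` with
`h(k) = Λ (r(k) φ)` continuous, `h(1) ≠ 0`; by continuity `∫ h̄ h = ∫ |h|² = 0`, contradicting the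
positivity of `μ` on open sets. Bröcker–tom Dieck (1985), III (5.6)–(5.7). [folklore] -/
theorem exists_smear_notMem [μ.IsOpenPosMeasure] (hφ : ∀ x, Continuous fun k => φ (x * ι k))
    (hE : FiniteDimensional ℂ (Submodule.span ℂ (Set.range fun k : G => fun x => φ (x * ι k))))
    (W' : Submodule ℂ (X → ℂ)) (hφW' : φ ∉ W') {D : Set C(G, ℂ)} (hD : Dense D) :
    ∃ p ∈ D, (fun x => ∫ k, p k * φ (x * ι k) ∂μ) ∉ W' := by
  by_contra hall
  push Not at hall
  set E := Submodule.span ℂ (Set.range fun k : G => fun x => φ (x * ι k))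
  haveI := hE
  have hmemE : ∀ k, (fun x => φ (x * ι k)) ∈ E := fun k => Submodule.subset_span ⟨k, rfl⟩
  have hφE : φ ∈ E := by simpa only [map_one, mul_one] using hmemE 1
  -- a functional on `E` killing `W' ∩ E` but not `φ`; it is a finite combination of evaluations
  have hφE' : (⟨φ, hφE⟩ : E) ∉ W'.comap E.subtype := fun h => hφW' (Submodule.mem_comap.1 h)
  obtain ⟨Λ, hΛφ, hΛE'⟩ := Submodule.exists_dual_map_eq_bot_of_notMem hφE' inferInstance
  have hΛ0 : ∀ v : E, (v : X → ℂ) ∈ W' → Λ v = 0 := fun v hv => by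
    have hv' : Λ v ∈ (W'.comap E.subtype).map Λ :=
      Submodule.mem_map_of_mem (show v ∈ W'.comap E.subtype from hv)
    rw [hΛE'] at hv'; exact (Submodule.mem_bot ℂ).1 hv'
  obtain ⟨c, hc⟩ := exists_finsupp_sum_eval_eq E Λ
  -- `h(k) = Λ (r(k) φ)`, continuous with `h(1) ≠ 0`
  let h : C(G, ℂ) := ⟨fun k => ∑ x ∈ c.support, c x * φ (x * ι k),
    continuous_finsetSum _ fun x _ => continuous_const.mul (hφ x)⟩
  have hhsum : ∀ k, h k = c.sum fun x a => a * φ (x * ι k) := fun _ => rfl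
  have hh1 : h 1 ≠ 0 := by
    have heq : (⟨fun x => φ (x * ι 1), hmemE 1⟩ : E) = ⟨φ, hφE⟩ :=
      Subtype.ext (funext fun x => by simp only [map_one, mul_one])
    have h1 : h 1 = Λ ⟨fun x => φ (x * ι 1), hmemE 1⟩ := by rw [hhsum, ← hc]
    rw [h1, heq]
    exact hΛφ
  -- `∫ p h = Λ (φ ⋆ p) = 0` for `p ∈ D`
  have hvan : ∀ p ∈ D, ∫ k, p k * h k ∂μ = 0 := fun p hp => by
    have h0 : Λ ⟨_, smear_mem_span μ ι hφ hE p⟩ = 0 := hΛ0 _ (hall p hp)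
    rw [← hc] at h0
    have h2 : (c.sum fun x a => a * ∫ k, p k * φ (x * ι k) ∂μ) = ∫ k, p k * h k ∂μ := by
      rw [finsupp_sum_integral μ ι hφ c p]; simp only [hhsum]
    exact h2 ▸ h0
  -- hence `∫ p h = 0` for every `p` (density and continuity), in particular `∫ h̄ h = 0`
  obtain ⟨I, hI⟩ := exists_integral_clm μ h
  have hI0 : I (star h) = 0 := by
    have hsubD : D ⊆ {q : C(G, ℂ) | I q = 0} := fun q hq => (hI q).trans (hvan q hq)
    have huniv : {q : C(G, ℂ) | I q = 0} = Set.univ := by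
      rw [← (isClosed_eq I.continuous continuous_const).closure_eq]
      exact (hD.mono hsubD).closure_eq
    exact (huniv ▸ Set.mem_univ (star h) : star h ∈ {q : C(G, ℂ) | I q = 0})
  -- but `∫ h̄ h = ∫ |h|² > 0`
  have hpos : (0 : ℝ) < ∫ k, ‖h k‖ ^ 2 ∂μ :=
    Continuous.integral_pos_of_hasCompactSupport_nonneg_nonzero (μ := μ) (x := 1)
      (h.continuous.norm.pow 2) (HasCompactSupport.of_compactSpace _) (fun k => sq_nonneg _)
      (pow_ne_zero _ (norm_ne_zero_iff.2 hh1))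
  rw [hI] at hI0
  simp only [ContinuousMap.star_apply, Complex.star_def, Complex.conj_mul', ← Complex.ofReal_pow,
    integral_complex_ofReal, Complex.ofReal_eq_zero] at hI0
  exact hpos.ne' hI0

end Helpers

section Main

variable {n : ℕ} {K : Type} [Field K] [NumberField K]

/-- **(A) — `K_∞`-type control by polynomial smearing.** A countable family of finite-dimensional
spaces `M d` of functions on `K_∞ = Kinf n K`, stable under `f ↦ f(· k₀)`, such that every
automorphic form `φ` outside a subspace `W'` of functions on `GL_n(𝔸_K)` has an element `ψ` of the
span of its `K_∞`-translates outside `W'` with all slices `k ↦ ψ (g k)` in one `M d`: `M d` = the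
matrix coefficients of the polynomial functions of degree `≤ d` on the compact matrix group `K_∞`
(`exists_polynomial_filtration`, `exists_coeffSpace`) and `ψ = φ ⋆ p = ∫_{K_∞} p(k) r(k) φ dk` for a
polynomial `p` (`smear_mem_span`, `integral_slice_mul`, `exists_smear_notMem`: the polynomials are
dense in `C(K_∞, ℂ)`). Borel–Jacquet (1979), 4.2–4.3; Bröcker–tom Dieck (1985), III (5.5)–(5.7).
[folklore] -/
theorem stub_A (hcpt : isCompact_glFiniteIntegralLevel n K) :
    ∃ M : ℕ → Submodule ℂ (Kinf n K → ℂ),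
      (∀ d, FiniteDimensional ℂ (M d)) ∧
      (∀ d (k₀ : Kinf n K), ∀ f ∈ M d, (fun k => f (k * k₀)) ∈ M d) ∧
      ∀ (W' : Submodule ℂ ((AdelicGroupData.gl n K).Adelic → ℂ)),
        (∀ k : Kinf n K, ∀ ψ ∈ W',
          rightTranslation (AdelicGroupData.gl n K) ((AutomorphyDatum.gl n K hcpt).ofK k) ψ ∈ W') →
        ∀ φ : (AdelicGroupData.gl n K).Adelic → ℂ,
          IsAutomorphicForm (AutomorphyDatum.gl n K hcpt) φ → φ ∉ W' →
          ∃ ψ ∈ Submodule.span ℂ (Set.range fun k : Kinf n K =>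
              rightTranslation (AdelicGroupData.gl n K) ((AutomorphyDatum.gl n K hcpt).ofK k) φ),
            ψ ∉ W' ∧ ∃ d, ∀ g : (AdelicGroupData.gl n K).Adelic,
              (fun k : Kinf n K => ψ (g * (AutomorphyDatum.gl n K hcpt).ofK k)) ∈ M d := by
  haveI : CompactSpace (Kinf n K) := isCompact_iff_compactSpace.mp (isCompact_Kinf_holds n K)
  letI : MeasurableSpace (Kinf n K) := borel _
  haveI : BorelSpace (Kinf n K) := ⟨rfl⟩
  -- the polynomial filtration of `C(K_∞, ℂ)` and its coefficient spaces `M d`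
  obtain ⟨P, hPfin, hPst, hPd⟩ := exists_polynomial_filtration (Kinf n K)
  have hM : ∀ d, ∃ M : Submodule ℂ (Kinf n K → ℂ), FiniteDimensional ℂ M ∧
      (∀ k₀ : Kinf n K, ∀ f ∈ M, (fun k => f (k * k₀)) ∈ M) ∧
      ∀ (Λ : C(Kinf n K, ℂ) →ₗ[ℂ] ℂ), ∀ q ∈ P d, (fun k => Λ (leftTranslate k q)) ∈ M :=
    fun d => haveI := hPfin d; exists_coeffSpace (P d) (hPst d)
  choose M hMfin hMst hMcoef using hM
  refine ⟨M, hMfin, hMst, ?_⟩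
  intro W' _ φ hφ hφW'
  set ι : Kinf n K →* (AdelicGroupData.gl n K).Adelic := (AutomorphyDatum.gl n K hcpt).ofK
  have hφc : ∀ x, Continuous fun k : Kinf n K => φ (x * ι k) := fun x => hφ.continuous_gl.comp
    (continuous_const.mul ((AutomorphyDatum.gl n K hcpt).continuous_ofArch.comp
      (continuous_induced_rng.2 continuous_subtype_val)))
  have hE : FiniteDimensional ℂ
      (Submodule.span ℂ (Set.range fun k : Kinf n K => fun x => φ (x * ι k))) := hφ.kFinite
  -- a polynomial `p` with `φ ⋆ p ∉ W'`; the slices of `φ ⋆ p` are matrix coefficients of `P d`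
  obtain ⟨p, hpD, hpW'⟩ := exists_smear_notMem Measure.haar ι hφc hE W' hφW' hPd
  obtain ⟨d, hpd⟩ := Set.mem_iUnion.1 hpD
  refine ⟨fun x => ∫ k, p k * φ (x * ι k) ∂Measure.haar, smear_mem_span Measure.haar ι hφc hE p,
    hpW', d, fun g => ?_⟩
  obtain ⟨Λ, hΛ⟩ :=
    exists_integral_clm (Measure.haar : Measure (Kinf n K)) ⟨fun k => φ (g * ι k), hφc g⟩
  have heq : ∀ k₁ : Kinf n K, ∫ k, p k * φ (g * ι k₁ * ι k) ∂Measure.haar =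
      (Λ : C(Kinf n K, ℂ) →ₗ[ℂ] ℂ) (leftTranslate k₁ p) := fun k₁ => by
    rw [ContinuousLinearMap.coe_coe, hΛ, integral_slice_mul Measure.haar ι p g k₁]; rfl
  show (fun k₁ : Kinf n K => ∫ k, p k * φ (g * ι k₁ * ι k) ∂Measure.haar) ∈ M d
  simp only [heq]
  exact hMcoef d _ p hpd

end Main

end Summit.Langlands.Langlands.Theorems.HeckeEigenvalueField.Baire

end
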